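import Literature.NumberTheory.Sieve.IwaniecAlmostPrimesProp2Lower
import HarnessLib

/-!
# Iwaniec (1978), Proposition 2: the lower bound with VARIABLE sieving levels — PROVED from Lemma 2 and Proposition 1

H. Iwaniec, *Almost-primes represented by quadratic polynomials*, Invent. Math. **47** (1978)
171–188, Proposition 2 (p. 185): after the upper bound the paper says only "A similar result
holds for lower bound, the function `F(s)` being replaced by `f(s)`"
[cite: IwaniecInventiones1978, Proposition 2].  The first file of this topic vendors that
sentence literally as the named fact `proposition2_lower` (arbitrary levels `z ≤ z_q < x^{1/2}`,
every `0 < γ < 1/2`); `IwaniecAlmostPrimesProp2Lower.lean` proved it only at a CONSTANT level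
(`proposition2_lower_const_of`), which is all that §6 uses.  This file proves the general form:

* `proposition2_lower_of : lemma2_bilinearSieve → proposition1_corollary → hK → hM2 →
   proposition2_lower` (`hK`, `hM2` = the two Mertens inputs for `ρ`, proved in
  `IwaniecAlmostPrimesMertens.lean`);
* `proposition2_lower_of_lemma2_of_proposition1 : lemma2_bilinearSieve → proposition1 →
   proposition2_lower`.

So `proposition2_lower` now rests on exactly the two named inputs of the rest of the paper,
`lemma2_bilinearSieve` (Acta Arith. 37 (1980), Theorem 1) and `proposition1` (p. 176).

## The point that "similarly" hides, and how it is settled here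

For the upper bound (p. 185 and `proposition2_upper_of`) the `q` of a class
`H(Q, Z) = {Q ≤ q < 2Q, Z ≤ z_q < 2Z}` are all sieved at one common level `u ≤ z_q`, using
`S(𝒜_q, z_q) ≤ S(𝒜_q, u)`; this has no lower analogue (raising the level to a common `u ≥ z_q`
destroys `(q, P(u)) = 1`).  So for the lower bound each `q` must be sieved by Lemma 2 at its own
level `z_q`, and then in the remainder `∑_{m<M} ∑_{n<N} [mn ∣ P(z_q)] a_m b_n r(𝒜; qmn)` the
coefficient of `n` that the Corollary of Proposition 1 must receive,
`b_n [n ∣ P(z_q)] = b_n [n squarefree] [P⁺(n) < z_q]` (`P⁺` = greatest prime factor), depends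
on `q` through the smoothness condition `P⁺(n) < z_q` as soon as `z_q < N = x^{1/15−ε'}`
(possible iff `γ < 1/15`; for the paper's `γ = 1/5` the condition is void).  We remove this
coupling by an exact separation of variables which costs only a factor `O(log x)`:
with `t = P⁺(n)` and `w = ⌈z_q⌉ − 1` (integers `< 2^K`, `K = ⌊log₂⌈N⌉⌋ + 1`),
`[t ≤ w] = [t = w] + ∑_{j<K} [⌊t/2^{j+1}⌋ = ⌊w/2^{j+1}⌋] [⌊t/2^j⌋ even] [⌊w/2^j⌋ odd]`
(`ite_le_eq_ite_eq_add_sum`, binary comparison), and on each of the `K + 1` levels the remaining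
EQUALITY constraint is separated by the orthogonality of the characters of the hypercube
`{±1}^V`, `[a = b] = 2^{−V} ∑_σ σ_a σ_b` (`sum_boolSign_mul_boolSign`): for every sign pattern
`σ` the twisted coefficients `b_n [n squarefree][bit condition] σ_{λ(n)}` are again bounded by `1`
and supported on squarefree `n`, so the Corollary of Proposition 1 bounds every twisted form by
the same `C(ε') x^{1−ε'}` and the average over `σ` is free (`abs_sum_mul_sum_ite_eq_le`).  The
pairs `(q, m)` of a dyadic class of `q` still inject into `m' = qm` although the levels vary
(`injOn_mul_dyadic_class`: if `z_{q₁} ≤ z_{q₂}` then `q₂ ∣ q₁`, and both lie in `[2^i, 2^{i+1})`).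
Altogether the remainder of a dyadic class is at most `(⌊log₂⌈N⌉⌋ + 2) C(ε') x^{1−ε'}` per
bilinear form (`abs_remainder_class_le_var`), and the total
`2(⌊log₂ x⌋ + 1)² e^{8ε₂⁻³} C(ε') x^{1−ε'}` is `≤ ε V(z) x` for large `x` exactly as before
(`eventually_classes_remainder_le`).  The main terms are treated per `q` by the lemmas of
`IwaniecAlmostPrimesProp2Prep.lean` (`main_term_lower`, `main_term_lower_trivial`,
`densityProd_level_le`) with `Z := z_q`, and the constant is the constant-level one,
`C_γ = (L_f/γ + f_max + c₀(1/γ + 33)) e²/γ + 1`.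

Design notes.  No new definitions: the greatest prime factor is written `n.primeFactors.sup id`
(value `0` at `n = 1`, which correctly makes `1 ∣ P(u)` unconditional), and the hypercube
characters are the explicit `if σ a then 1 else −1`, `σ : Fin V → Bool`.

## References

* H. Iwaniec, Invent. Math. 47 (1978) 171–188, Proposition 2 and §5 pp. 185–186
  (`IwaniecInventiones1978`).
* H. Iwaniec, Acta Arith. 37 (1980) 307–320, Theorem 1 (`IwaniecActaArith1980b`).
* V. Kapoor, *Almost-primes represented by quadratic polynomials*, arXiv:1910.02885, §5
  Proposition 13 (the upper bound only, as in the original).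
-/

open Finset Real Filter

noncomputable section

namespace Literature.NumberTheory.Sieve.Iwaniec1978

/-! ### Separation of variables on the hypercube -/

/-- **Orthogonality of the coordinate characters of the hypercube `{±1}^V`** (sign patterns
coded by `σ : Fin V → Bool`, `σ_a = ±1` according as `σ a` is true or false):
`∑_σ σ_a σ_b = 2^V [a = b]`. [folklore] -/
theorem sum_boolSign_mul_boolSign {V : ℕ} (a b : Fin V) :
    ∑ σ : Fin V → Bool, (if σ a then (1 : ℝ) else -1) * (if σ b then (1 : ℝ) else -1) =
      if a = b then (2 : ℝ) ^ V else 0 := by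
  split_ifs with hab
  · subst hab
    have h1 : ∀ σ : Fin V → Bool,
        (if σ a then (1 : ℝ) else -1) * (if σ a then (1 : ℝ) else -1) = 1 := by
      intro σ; split_ifs <;> norm_num
    simp only [h1, Finset.sum_const, Finset.card_univ, Fintype.card_fun, Fintype.card_bool,
      Fintype.card_fin, nsmul_eq_mul, mul_one]
    push_cast
    ring
  · set g : (Fin V → Bool) → ℝ := fun σ =>
      (if σ a then (1 : ℝ) else -1) * (if σ b then (1 : ℝ) else -1) with hg
    set flip : (Fin V → Bool) → (Fin V → Bool) := fun σ => Function.update σ a (!σ a)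
      with hflip_def
    have hflip : Function.Involutive flip := by
      intro σ
      ext k
      by_cases hk : k = a
      · subst hk
        simp [hflip_def]
      · simp [hflip_def, Function.update_of_ne hk]
    have key : ∀ σ : Fin V → Bool, g (flip σ) = -g σ := by
      intro σ
      have ha : flip σ a = !σ a := by simp [hflip_def]
      have hb : flip σ b = σ b := by
        have hne : b ≠ a := fun h => hab h.symm
        simp [hflip_def, Function.update_of_ne hne]
      simp only [hg, ha, hb]
      cases σ a <;> cases σ b <;> norm_num
    have hsum : ∑ σ, g (flip σ) = ∑ σ, g σ := Equiv.sum_comp hflip.toPerm g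
    have hneg : ∑ σ, g (flip σ) = -∑ σ, g σ := by
      rw [← Finset.sum_neg_distrib]
      exact Finset.sum_congr rfl fun σ _ => key σ
    linarith

/-- **Separation of an equality constraint between the two sides of a bilinear form** (hypercube
orthogonality): if the pairs `p` inject into the keys `m'`, `|α_p| ≤ 1`, the colours `κ(p)`,
`λ(n)` are `< V`, and for every `φ` bounded by `1` the twisted forms satisfy
`∑_{m'} |∑_n φ(n) β_n r(m', n)| ≤ B`, then `|∑_p α_p ∑_n [λ(n) = κ(p)] β_n r(key p, n)| ≤ B`
(expand `[λ = κ] = 2^{−V} ∑_σ σ_λ σ_κ` and average). [folklore] -/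
theorem abs_sum_mul_sum_ite_eq_le {ι : Type*} (P : Finset ι) (key κ : ι → ℕ) (α : ι → ℝ)
    (S : Finset ℕ) (lam : ℕ → ℕ) (β : ℕ → ℝ) (r : ℕ → ℕ → ℝ) (V : ℕ)
    (hκ : ∀ p ∈ P, κ p < V) (hlam : ∀ n ∈ S, lam n < V) (hα : ∀ p ∈ P, |α p| ≤ 1)
    (hinj : Set.InjOn key ↑P) (Keys : Finset ℕ) (hkeys : ∀ p ∈ P, key p ∈ Keys) {B : ℝ}
    (hB : ∀ φ : ℕ → ℝ, (∀ n, |φ n| ≤ 1) →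
      ∑ m' ∈ Keys, |∑ n ∈ S, φ n * β n * r m' n| ≤ B) :
    |∑ p ∈ P, α p * ∑ n ∈ S, (if lam n = κ p then β n * r (key p) n else 0)| ≤ B := by
  classical
  -- the coordinate characters, extended by `1` beyond `V`
  set χ : (Fin V → Bool) → ℕ → ℝ := fun σ v =>
    if h : v < V then (if σ ⟨v, h⟩ then 1 else -1) else 1 with hχ
  have hχabs : ∀ σ v, |χ σ v| = 1 := by
    intro σ v; rw [hχ]; dsimp only; split_ifs <;> norm_num
  have horth : ∀ a b : ℕ, a < V → b < V →
      ∑ σ : Fin V → Bool, χ σ a * χ σ b = if a = b then (2 : ℝ) ^ V else 0 := by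
    intro a b ha hb
    have h := sum_boolSign_mul_boolSign (⟨a, ha⟩ : Fin V) ⟨b, hb⟩
    simp only [Fin.mk.injEq] at h
    rw [← h, hχ]
    refine Finset.sum_congr rfl fun σ _ => ?_
    dsimp only
    rw [dif_pos ha, dif_pos hb]
  set Bs : (Fin V → Bool) → ℕ → ℝ := fun σ m' => ∑ n ∈ S, χ σ (lam n) * β n * r m' n
    with hBs
  have h2V : (0 : ℝ) < (2 : ℝ) ^ V := by positivity
  -- expand the indicator through the characters
  have hind : ∀ p ∈ P, ∀ n ∈ S, (if lam n = κ p then β n * r (key p) n else 0) =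
      ∑ σ : Fin V → Bool, ((2 : ℝ) ^ V)⁻¹ *
        (χ σ (κ p) * (χ σ (lam n) * β n * r (key p) n)) := by
    intro p hp n hn
    have h := horth (lam n) (κ p) (hlam n hn) (hκ p hp)
    have e : (if lam n = κ p then β n * r (key p) n else 0) =
        ((2 : ℝ) ^ V)⁻¹ * (if lam n = κ p then (2 : ℝ) ^ V else 0) * (β n * r (key p) n) := by
      split_ifs
      · field_simp
      · simp
    rw [e, ← h, Finset.mul_sum, Finset.sum_mul]
    exact Finset.sum_congr rfl fun σ _ => by ring
  have hinner : ∀ p ∈ P, α p * ∑ n ∈ S, (if lam n = κ p then β n * r (key p) n else 0) =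
      ∑ σ : Fin V → Bool, ((2 : ℝ) ^ V)⁻¹ * (α p * χ σ (κ p) * Bs σ (key p)) := by
    intro p hp
    rw [Finset.sum_congr rfl (hind p hp), Finset.sum_comm, Finset.mul_sum]
    refine Finset.sum_congr rfl fun σ _ => ?_
    rw [hBs]
    dsimp only
    rw [Finset.mul_sum, Finset.mul_sum, Finset.mul_sum]
    exact Finset.sum_congr rfl fun n _ => by ring
  rw [Finset.sum_congr rfl hinner, Finset.sum_comm]
  -- take absolute values
  have hσ : ∀ σ : Fin V → Bool,
      |∑ p ∈ P, ((2 : ℝ) ^ V)⁻¹ * (α p * χ σ (κ p) * Bs σ (key p))| ≤ ((2 : ℝ) ^ V)⁻¹ * B := by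
    intro σ
    rw [← Finset.mul_sum, abs_mul, abs_of_pos (inv_pos.mpr h2V)]
    refine mul_le_mul_of_nonneg_left ?_ (inv_pos.mpr h2V).le
    calc |∑ p ∈ P, α p * χ σ (κ p) * Bs σ (key p)|
        ≤ ∑ p ∈ P, |α p * χ σ (κ p) * Bs σ (key p)| := Finset.abs_sum_le_sum_abs _ _
      _ ≤ ∑ p ∈ P, |Bs σ (key p)| := by
          refine Finset.sum_le_sum fun p hp => ?_
          rw [abs_mul, abs_mul, hχabs, mul_one]
          exact mul_le_of_le_one_left (abs_nonneg _) (hα p hp)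
      _ = ∑ m' ∈ P.image key, |Bs σ m'| := by
          rw [Finset.sum_image]
          intro p₁ hp₁ p₂ hp₂ h
          exact hinj hp₁ hp₂ h
      _ ≤ ∑ m' ∈ Keys, |Bs σ m'| := by
          refine Finset.sum_le_sum_of_subset_of_nonneg (fun m' hm' => ?_) fun _ _ _ => abs_nonneg _
          obtain ⟨p, hp, rfl⟩ := Finset.mem_image.mp hm'
          exact hkeys p hp
      _ ≤ B := hB (fun n => χ σ (lam n)) fun n => (hχabs σ (lam n)).le
  calc |∑ σ : Fin V → Bool, ∑ p ∈ P, ((2 : ℝ) ^ V)⁻¹ * (α p * χ σ (κ p) * Bs σ (key p))|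
      ≤ ∑ σ : Fin V → Bool, |∑ p ∈ P, ((2 : ℝ) ^ V)⁻¹ * (α p * χ σ (κ p) * Bs σ (key p))| :=
        Finset.abs_sum_le_sum_abs _ _
    _ ≤ ∑ _σ : Fin V → Bool, ((2 : ℝ) ^ V)⁻¹ * B := Finset.sum_le_sum fun σ _ => hσ σ
    _ = B := by
        rw [Finset.sum_const, Finset.card_univ, Fintype.card_fun, Fintype.card_bool,
          Fintype.card_fin, nsmul_eq_mul]
        push_cast
        field_simp

/-- **Binary comparison**: for `t, w < 2^K`,
`[t ≤ w] = [t = w] + ∑_{j<K} [⌊t/2^{j+1}⌋ = ⌊w/2^{j+1}⌋] [⌊t/2^j⌋ even] [⌊w/2^j⌋ odd]`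
(the `j`-th term detects the highest binary digit in which `t` and `w` differ). [folklore] -/
theorem ite_le_eq_ite_eq_add_sum (K : ℕ) : ∀ t w : ℕ, t < 2 ^ K → w < 2 ^ K →
    (if t ≤ w then (1 : ℝ) else 0) = (if t = w then (1 : ℝ) else 0) +
      ∑ j ∈ Finset.range K,
        (if t / 2 ^ (j + 1) = w / 2 ^ (j + 1) ∧ t / 2 ^ j % 2 = 0 ∧ w / 2 ^ j % 2 = 1
          then (1 : ℝ) else 0) := by
  induction K with
  | zero =>
    intro t w ht hw
    simp only [pow_zero, Nat.lt_one_iff] at ht hw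
    subst ht; subst hw
    simp
  | succ K ih =>
    intro t w ht hw
    have ht2 : t / 2 < 2 ^ K := by
      rw [pow_succ] at ht; omega
    have hw2 : w / 2 < 2 ^ K := by
      rw [pow_succ] at hw; omega
    have hih := ih (t / 2) (w / 2) ht2 hw2
    rw [Finset.sum_range_succ']
    have hshift : ∀ j ∈ Finset.range K,
        (if t / 2 ^ (j + 1 + 1) = w / 2 ^ (j + 1 + 1) ∧ t / 2 ^ (j + 1) % 2 = 0 ∧
            w / 2 ^ (j + 1) % 2 = 1 then (1 : ℝ) else 0) =
        (if t / 2 / 2 ^ (j + 1) = w / 2 / 2 ^ (j + 1) ∧ t / 2 / 2 ^ j % 2 = 0 ∧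
            w / 2 / 2 ^ j % 2 = 1 then (1 : ℝ) else 0) := by
      intro j _
      have e1 : ∀ u : ℕ, u / 2 / 2 ^ (j + 1) = u / 2 ^ (j + 1 + 1) := fun u => by
        rw [Nat.div_div_eq_div_mul, pow_succ 2 (j + 1), mul_comm]
      have e2 : ∀ u : ℕ, u / 2 / 2 ^ j = u / 2 ^ (j + 1) := fun u => by
        rw [Nat.div_div_eq_div_mul, pow_succ, mul_comm]
      rw [e1, e1, e2, e2]
    rw [Finset.sum_congr rfl hshift, ← sub_eq_iff_eq_add'.mpr hih]
    simp only [pow_zero, Nat.div_one, zero_add, pow_one]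
    split_ifs <;> first | (exfalso; omega) | norm_num


/-! ### Divisors of `P(u)` through the greatest prime factor, and injectivity on a dyadic class -/

/-- The greatest prime factor `P⁺(n) = n.primeFactors.sup id` is at most `n`. [folklore] -/
theorem sup_primeFactors_le (n : ℕ) : n.primeFactors.sup id ≤ n :=
  Finset.sup_le fun _ hp => Nat.le_of_mem_primeFactors hp

/-- `n ∣ P(u)` iff `n` is squarefree and its greatest prime factor `P⁺(n) = n.primeFactors.sup id`
is `< ⌈u⌉` (i.e. all prime factors are `< u`; here `⌈u⌉ ≥ 1`, and `P⁺(1) = 0`). [folklore] -/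
theorem dvd_primesProdBelow_iff_squarefree_and_sup_lt (n : ℕ) (u : ℝ) (hu : 0 < ⌈u⌉₊) :
    n ∣ primesProdBelow u ↔ Squarefree n ∧ n.primeFactors.sup id < ⌈u⌉₊ := by
  constructor
  · intro h
    refine ⟨(squarefree_primesProdBelow u).squarefree_of_dvd h, ?_⟩
    rw [Finset.sup_lt_iff (show (⊥ : ℕ) < ⌈u⌉₊ from hu)]
    intro p hp
    have hp' : p ∈ (primesProdBelow u).primeFactors :=
      Nat.primeFactors_mono h (primesProdBelow_ne_zero u) hp
    rw [primeFactors_primesProdBelow, Nat.mem_primesBelow] at hp'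
    exact hp'.1
  · rintro ⟨hsq, hlt⟩
    rw [Finset.sup_lt_iff (show (⊥ : ℕ) < ⌈u⌉₊ from hu)] at hlt
    have hsub : n.primeFactors ⊆ Nat.primesBelow ⌈u⌉₊ := by
      intro p hp
      rw [Nat.mem_primesBelow]
      exact ⟨hlt p hp, Nat.prime_of_mem_primeFactors hp⟩
    rw [← Nat.prod_primeFactors_of_squarefree hsq, primesProdBelow]
    exact Finset.prod_dvd_prod_of_subset _ _ _ hsub

/-- **Injectivity of `(q, m) ↦ qm` on a dyadic class with variable levels**: if `2^i ≤ q₁, q₂ < 2^{i+1}`,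
`(q_k, P(z_{q_k})) = 1`, `m_k ∣ P(z_{q_k})` and `z_{q₁} ≤ z_{q₂}`, then `q₁ m₁ = q₂ m₂` forces
`q₁ = q₂` (indeed `q₂ ∣ q₁` and both lie in the same dyadic interval). [folklore] -/
theorem eq_of_mul_eq_mul_of_level_le {q₁ q₂ m₁ m₂ i : ℕ} {z₁ z₂ : ℝ} (hz : z₁ ≤ z₂)
    (hq₁ : 2 ^ i ≤ q₁ ∧ q₁ < 2 ^ (i + 1)) (hq₂ : 2 ^ i ≤ q₂ ∧ q₂ < 2 ^ (i + 1))
    (hcop₂ : q₂.Coprime (primesProdBelow z₂)) (hm₁ : m₁ ∣ primesProdBelow z₁)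
    (h : q₁ * m₁ = q₂ * m₂) : q₁ = q₂ := by
  have hm₁' : m₁ ∣ primesProdBelow z₂ := dvd_trans hm₁ (primesProdBelow_dvd_of_le hz)
  have hcop : q₂.Coprime m₁ := Nat.Coprime.coprime_dvd_right hm₁' hcop₂
  have hdvd : q₂ ∣ q₁ * m₁ := ⟨m₂, h⟩
  have hdvd' : q₂ ∣ q₁ := hcop.dvd_of_dvd_mul_right hdvd
  obtain ⟨k, hk⟩ := hdvd'
  have hpos : 0 < 2 ^ i := pow_pos (by norm_num) i
  rcases k with _ | _ | k
  · omega
  · omega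
  · have : q₂ * 2 ≤ q₂ * (k + 1 + 1) := Nat.mul_le_mul_left _ (by omega)
    rw [pow_succ] at hq₁ hq₂
    omega

/-- The pairs `(q, m)` with `q` in a dyadic class, `(q, P(z_q)) = 1`, `m ∣ P(z_q)` inject into
`m' = qm`. [folklore] -/
theorem injOn_mul_dyadic_class (zq : ℕ → ℝ) (i : ℕ) (T : Finset ℕ) (I : Finset ℕ)
    (hT : ∀ q ∈ T, 0 < q ∧ q.Coprime (primesProdBelow (zq q)) ∧ 2 ^ i ≤ q ∧ q < 2 ^ (i + 1)) :
    Set.InjOn (fun qm : ℕ × ℕ => qm.1 * qm.2)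
      ↑((T ×ˢ I).filter fun qm : ℕ × ℕ => qm.2 ∣ primesProdBelow (zq qm.1)) := by
  rintro ⟨q₁, m₁⟩ h₁ ⟨q₂, m₂⟩ h₂ heq
  simp only [Finset.coe_filter, Finset.mem_product, Set.mem_setOf_eq] at h₁ h₂
  simp only at heq
  obtain ⟨⟨hq₁T, -⟩, hm₁⟩ := h₁
  obtain ⟨⟨hq₂T, -⟩, hm₂⟩ := h₂
  obtain ⟨hq₁0, hcop₁, hlo₁, hhi₁⟩ := hT q₁ hq₁T
  obtain ⟨hq₂0, hcop₂, hlo₂, hhi₂⟩ := hT q₂ hq₂T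
  have hq : q₁ = q₂ := by
    rcases le_total (zq q₁) (zq q₂) with hz | hz
    · exact eq_of_mul_eq_mul_of_level_le hz ⟨hlo₁, hhi₁⟩ ⟨hlo₂, hhi₂⟩ hcop₂ hm₁ heq
    · exact (eq_of_mul_eq_mul_of_level_le hz ⟨hlo₂, hhi₂⟩ ⟨hlo₁, hhi₁⟩ hcop₁ hm₂ heq.symm).symm
  subst hq
  have hm : m₁ = m₂ := Nat.eq_of_mul_eq_mul_left hq₁0 heq
  subst hm
  rfl

/-! ### The remainder of a dyadic class with variable sieving levels -/

set_option maxHeartbeats 800000 in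
/-- **The remainder of a dyadic class with VARIABLE sieving levels is admissible for the Corollary
of Proposition 1.**  For `q` in a dyadic class `[2^i, 2^{i+1})`, each coprime to `P(z_q)`
(`z_q ≥ 2`) and with `qM ≤ x^{1−4ε'}`, and coefficients bounded by `1`:
`|∑_{q} c_q ∑_{m<M} ∑_{n<N} [mn ∣ P(z_q)] a_m b_n r(𝒜; qmn)| ≤ (⌊log₂⌈N⌉⌋ + 2) · B`, where `B`
bounds `∑_{m' < x^{1−4ε'}} |B(x; m', N)|` over all admissible `b'` (what the Corollary of
Proposition 1 provides).  The coupling `[P⁺(n) < z_q]` between `n` and `q` inside `[n ∣ P(z_q)]`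
(absent when `z_q` is constant, `abs_remainder_class_le`) is removed by the binary comparison of
`P⁺(n)` with `⌈z_q⌉ − 1` (`ite_le_eq_ite_eq_add_sum`, `⌊log₂⌈N⌉⌋ + 2` levels) and, on each level,
the hypercube separation `abs_sum_mul_sum_ite_eq_le`; the pairs `(q, m)` still inject into
`m' = qm` (`injOn_mul_dyadic_class`). [cite: IwaniecInventiones1978, §5 p. 186] -/
theorem abs_remainder_class_le_var (x M N D : ℝ) (zq : ℕ → ℝ) (i : ℕ) (T : Finset ℕ)
    (c a b : ℕ → ℝ)
    (hT : ∀ q ∈ T, 0 < q ∧ q.Coprime (primesProdBelow (zq q)) ∧ (q : ℝ) * M ≤ D ∧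
      2 ^ i ≤ q ∧ q < 2 ^ (i + 1) ∧ 2 ≤ zq q)
    (hc : ∀ q, |c q| ≤ 1) (ha : ∀ m, |a m| ≤ 1) (hb : ∀ n, |b n| ≤ 1) {B : ℝ}
    (hB : ∀ b' : ℕ → ℝ, (∀ n, |b' n| ≤ 1) → (∀ n, ¬ Squarefree n → b' n = 0) →
      ∑ m' ∈ Finset.Ico 1 ⌈D⌉₊, |bilinearB x b' m' N| ≤ B) :
    |∑ q ∈ T, c q * ∑ m ∈ Finset.Ico 1 ⌈M⌉₊, ∑ n ∈ Finset.Ico 1 ⌈N⌉₊,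
        (if m * n ∣ primesProdBelow (zq q) then a m * b n * rem x (q * (m * n)) else 0)| ≤
      ((Nat.log 2 ⌈N⌉₊ : ℝ) + 2) * B := by
  classical
  -- notation; `t n = P⁺(n)` is the greatest prime factor
  set t : ℕ → ℕ := fun n => n.primeFactors.sup id with ht
  set S := Finset.Ico 1 ⌈N⌉₊ with hS
  set W := ⌈N⌉₊ with hW
  set K := Nat.log 2 W + 1 with hK
  set VV := 2 ^ K with hVV
  have hWV : W < VV := by rw [hVV, hK]; exact Nat.lt_pow_succ_log_self one_lt_two W
  set w : ℕ → ℕ := fun q => min (⌈zq q⌉₊ - 1) (W - 1) with hw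
  set β : ℕ → ℝ := fun n => if Squarefree n then b n else 0 with hβ
  set r : ℕ → ℕ → ℝ := fun m' n => if n.Coprime m' then rem x (m' * n) else 0 with hr
  set Pairs := (T ×ˢ Finset.Ico 1 ⌈M⌉₊).filter
    (fun qm : ℕ × ℕ => qm.2 ∣ primesProdBelow (zq qm.1)) with hPairs
  set key : ℕ × ℕ → ℕ := fun qm => qm.1 * qm.2 with hkey
  set α : ℕ × ℕ → ℝ := fun qm => c qm.1 * a qm.2 with hα
  set Keys := Finset.Ico 1 ⌈D⌉₊ with hKeys
  -- `B ≥ 0`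
  have hB0 : 0 ≤ B := by
    have h := hB (fun _ => 0) (by simp) (by simp)
    exact le_trans (Finset.sum_nonneg fun _ _ => abs_nonneg _) h
  -- basic bounds
  have htS : ∀ n ∈ S, t n < VV ∧ t n ≤ W - 1 := by
    intro n hn
    have hn' := Finset.mem_Ico.mp hn
    have h1 : t n ≤ n := sup_primeFactors_le n
    omega
  have hwV : ∀ q, w q < VV := by
    intro q
    have : w q ≤ W - 1 := min_le_right _ _
    omega
  -- Step 1: the divisibility indicator through `P⁺(n) ≤ w_q`
  have hdvd_iff : ∀ q ∈ T, ∀ n ∈ S,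
      (n ∣ primesProdBelow (zq q) ↔ Squarefree n ∧ t n ≤ w q) := by
    intro q hq n hn
    have hn' := Finset.mem_Ico.mp hn
    have hz2 := (hT q hq).2.2.2.2.2
    have hceil1 : 1 < ⌈zq q⌉₊ := Nat.lt_ceil.mpr (by push_cast; linarith)
    have hceil : 2 ≤ ⌈zq q⌉₊ := hceil1
    rw [dvd_primesProdBelow_iff_squarefree_and_sup_lt n (zq q) (by omega)]
    change Squarefree n ∧ t n < ⌈zq q⌉₊ ↔ _
    have hg := (htS n hn).2
    have hw1 : w q ≤ ⌈zq q⌉₊ - 1 := min_le_left _ _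
    constructor
    · rintro ⟨hsq, hlt⟩
      exact ⟨hsq, le_min (by omega) hg⟩
    · rintro ⟨hsq, hle⟩
      exact ⟨hsq, by omega⟩
  -- Step 2: rewrite the class sum as a sum over pairs with the comparison indicator
  have hstep2 : ∑ q ∈ T, c q * ∑ m ∈ Finset.Ico 1 ⌈M⌉₊, ∑ n ∈ S,
      (if m * n ∣ primesProdBelow (zq q) then a m * b n * rem x (q * (m * n)) else 0) =
      ∑ p ∈ Pairs, α p * ∑ n ∈ S,
        (if t n ≤ w p.1 then (1 : ℝ) else 0) * (β n * r (key p) n) := by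
    rw [hPairs, Finset.sum_filter, Finset.sum_product]
    refine Finset.sum_congr rfl fun q hq => ?_
    have hcop := (hT q hq).2.1
    rw [remainder_eq_sum_bilinearB x (zq q) M N hcop a b, Finset.sum_filter, Finset.mul_sum]
    refine Finset.sum_congr rfl fun m hm => ?_
    by_cases hmP : m ∣ primesProdBelow (zq q)
    · rw [if_pos hmP, if_pos hmP, hα, hkey]
      dsimp only
      rw [mul_assoc]
      congr 1
      rw [bilinearB, Finset.sum_filter, Finset.mul_sum, Finset.mul_sum]
      refine Finset.sum_congr rfl fun n hn => ?_
      have hiff := hdvd_iff q hq n hn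
      rw [hβ, hr]
      dsimp only
      by_cases hsq : Squarefree n
      · by_cases hg : t n ≤ w q
        · have hd : n ∣ primesProdBelow (zq q) := hiff.mpr ⟨hsq, hg⟩
          simp only [hd, hsq, hg, if_true]
          split_ifs <;> ring
        · have hd : ¬ n ∣ primesProdBelow (zq q) := fun h => hg (hiff.mp h).2
          simp only [hd, hg, if_false]
          split_ifs <;> ring
      · have hd : ¬ n ∣ primesProdBelow (zq q) := fun h => hsq (hiff.mp h).1
        simp only [hd, hsq, if_false]
        split_ifs <;> ring
    · rw [if_neg hmP, if_neg hmP, mul_zero]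
  -- Step 3: the binary comparison, level by level
  have hstep3 : ∀ p ∈ Pairs, ∀ n ∈ S,
      (if t n ≤ w p.1 then (1 : ℝ) else 0) * (β n * r (key p) n) =
      (if t n = w p.1 then β n * r (key p) n else 0) +
        ∑ j ∈ Finset.range K,
          (if (w p.1 / 2 ^ j) % 2 = 1 then (1 : ℝ) else 0) *
            (if t n / 2 ^ (j + 1) = w p.1 / 2 ^ (j + 1) then
              (if (t n / 2 ^ j) % 2 = 0 then β n else 0) * r (key p) n else 0) := by
    intro p _ n hn
    rw [ite_le_eq_ite_eq_add_sum K (t n) (w p.1) (htS n hn).1 (hwV p.1), add_mul,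
      Finset.sum_mul]
    congr 1
    · split_ifs <;> simp
    · refine Finset.sum_congr rfl fun j _ => ?_
      by_cases h1 : t n / 2 ^ (j + 1) = w p.1 / 2 ^ (j + 1) <;>
      by_cases h2 : t n / 2 ^ j % 2 = 0 <;>
      by_cases h3 : w p.1 / 2 ^ j % 2 = 1 <;>
      simp [h1, h2, h3]
  -- the pairs inject into the keys, which lie below `D`
  have hTinj : ∀ q ∈ T, 0 < q ∧ q.Coprime (primesProdBelow (zq q)) ∧ 2 ^ i ≤ q ∧ q < 2 ^ (i + 1) :=
    fun q hq => ⟨(hT q hq).1, (hT q hq).2.1, (hT q hq).2.2.2.1, (hT q hq).2.2.2.2.1⟩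
  have hinj : Set.InjOn key ↑Pairs := injOn_mul_dyadic_class zq i T _ hTinj
  have hkeys : ∀ p ∈ Pairs, key p ∈ Keys := by
    rintro ⟨q, m⟩ hp
    rw [hPairs, Finset.mem_filter, Finset.mem_product] at hp
    obtain ⟨⟨hq, hm⟩, -⟩ := hp
    obtain ⟨hq0, -, hqM, -⟩ := hT q hq
    have hm1 : 1 ≤ m := (Finset.mem_Ico.mp hm).1
    have hmM : m < ⌈M⌉₊ := (Finset.mem_Ico.mp hm).2
    rw [hKeys, Finset.mem_Ico, hkey]
    dsimp only
    refine ⟨Nat.one_le_iff_ne_zero.mpr (mul_ne_zero hq0.ne' (by omega)), Nat.lt_ceil.mpr ?_⟩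
    have hmM' : (m : ℝ) < M := by
      have := Nat.lt_ceil.mp hmM
      exact_mod_cast this
    have hq' : (0 : ℝ) < q := by exact_mod_cast hq0
    push_cast
    calc (q : ℝ) * m < q * M := by gcongr
      _ ≤ D := hqM
  have hαle : ∀ p ∈ Pairs, |α p| ≤ 1 := by
    intro p _
    rw [hα]; dsimp only
    rw [abs_mul]
    exact mul_le_one₀ (hc _) (abs_nonneg _) (ha _)
  -- the twisted forms are `B(x; m', N)` with admissible coefficients
  have hform : ∀ (φ : ℕ → ℝ) (β' : ℕ → ℝ), (∀ n, |φ n| ≤ 1) → (∀ n, |β' n| ≤ 1) →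
      (∀ n, ¬ Squarefree n → β' n = 0) →
      ∑ m' ∈ Keys, |∑ n ∈ S, φ n * β' n * r m' n| ≤ B := by
    intro φ β' hφ hβ' hβ'0
    have h := hB (fun n => φ n * β' n) (fun n => by
      rw [abs_mul]; exact mul_le_one₀ (hφ n) (abs_nonneg _) (hβ' n))
      (fun n hn' => by simp [hβ'0 n hn'])
    refine le_of_eq_of_le (Finset.sum_congr rfl fun m' _ => ?_) h
    congr 1
    rw [bilinearB, Finset.sum_filter]
    refine Finset.sum_congr rfl fun n _ => ?_
    rw [hr]; dsimp only
    split_ifs <;> ring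
  have hβle : ∀ n, |β n| ≤ 1 := fun n => by
    rw [hβ]; dsimp only; split_ifs <;> simp [hb n]
  have hβ0 : ∀ n, ¬ Squarefree n → β n = 0 := fun n hn => by
    rw [hβ]; dsimp only; rw [if_neg hn]
  -- level `K` (the equality term)
  have hE : |∑ p ∈ Pairs, α p * ∑ n ∈ S, (if t n = w p.1 then β n * r (key p) n else 0)| ≤ B := by
    refine abs_sum_mul_sum_ite_eq_le Pairs key (fun p => w p.1) α S t β r VV
      (fun p _ => hwV p.1) (fun n hn => (htS n hn).1) hαle hinj Keys hkeys fun φ hφ => ?_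
    exact hform φ β hφ hβle hβ0
  -- the levels `j < K`
  have hJ : ∀ j ∈ Finset.range K,
      |∑ p ∈ Pairs, (α p * (if (w p.1 / 2 ^ j) % 2 = 1 then (1 : ℝ) else 0)) *
        ∑ n ∈ S, (if t n / 2 ^ (j + 1) = w p.1 / 2 ^ (j + 1) then
          (if (t n / 2 ^ j) % 2 = 0 then β n else 0) * r (key p) n else 0)| ≤ B := by
    intro j _
    refine abs_sum_mul_sum_ite_eq_le Pairs key (fun p => w p.1 / 2 ^ (j + 1))
      (fun p => α p * (if (w p.1 / 2 ^ j) % 2 = 1 then (1 : ℝ) else 0)) S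
      (fun n => t n / 2 ^ (j + 1)) (fun n => if (t n / 2 ^ j) % 2 = 0 then β n else 0) r VV
      (fun p _ => lt_of_le_of_lt (Nat.div_le_self _ _) (hwV p.1))
      (fun n hn => lt_of_le_of_lt (Nat.div_le_self _ _) (htS n hn).1)
      (fun p hp => ?_) hinj Keys hkeys fun φ hφ => ?_
    · rw [abs_mul]
      refine mul_le_one₀ (hαle p hp) (abs_nonneg _) ?_
      split_ifs <;> simp
    · refine hform φ (fun n => if (t n / 2 ^ j) % 2 = 0 then β n else 0) hφ (fun n => ?_)
        (fun n hn => ?_)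
      · split_ifs
        · exact hβle n
        · simp
      · split_ifs
        · exact hβ0 n hn
        · rfl
  -- assemble
  rw [hstep2, Finset.sum_congr rfl fun p hp => by
    rw [Finset.sum_congr rfl (hstep3 p hp)]]
  simp_rw [Finset.sum_add_distrib, mul_add]
  rw [Finset.sum_add_distrib]
  have hswap : ∑ p ∈ Pairs, α p * ∑ n ∈ S, ∑ j ∈ Finset.range K,
      (if (w p.1 / 2 ^ j) % 2 = 1 then (1 : ℝ) else 0) *
        (if t n / 2 ^ (j + 1) = w p.1 / 2 ^ (j + 1) then
          (if (t n / 2 ^ j) % 2 = 0 then β n else 0) * r (key p) n else 0) =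
      ∑ j ∈ Finset.range K, ∑ p ∈ Pairs,
        (α p * (if (w p.1 / 2 ^ j) % 2 = 1 then (1 : ℝ) else 0)) *
          ∑ n ∈ S, (if t n / 2 ^ (j + 1) = w p.1 / 2 ^ (j + 1) then
            (if (t n / 2 ^ j) % 2 = 0 then β n else 0) * r (key p) n else 0) := by
    rw [Finset.sum_comm]
    refine Finset.sum_congr rfl fun p _ => ?_
    rw [Finset.sum_comm, Finset.mul_sum]
    refine Finset.sum_congr rfl fun j _ => ?_
    rw [Finset.mul_sum, Finset.mul_sum]
    exact Finset.sum_congr rfl fun n _ => by ring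
  rw [hswap]
  calc |∑ p ∈ Pairs, α p * ∑ n ∈ S, (if t n = w p.1 then β n * r (key p) n else 0) +
        ∑ j ∈ Finset.range K, ∑ p ∈ Pairs,
          (α p * (if (w p.1 / 2 ^ j) % 2 = 1 then (1 : ℝ) else 0)) *
            ∑ n ∈ S, (if t n / 2 ^ (j + 1) = w p.1 / 2 ^ (j + 1) then
              (if (t n / 2 ^ j) % 2 = 0 then β n else 0) * r (key p) n else 0)|
      ≤ B + ∑ j ∈ Finset.range K, B := by
        refine (abs_add_le _ _).trans (add_le_add hE ?_)
        exact (Finset.abs_sum_le_sum_abs _ _).trans (Finset.sum_le_sum hJ)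
    _ = ((Nat.log 2 ⌈N⌉₊ : ℝ) + 2) * B := by
        rw [Finset.sum_const, Finset.card_range, nsmul_eq_mul, hK, hW]
        push_cast
        ring


/-! ### Proposition 2, lower bound with variable levels, from Lemma 2 and the Corollary of Proposition 1 -/

set_option maxHeartbeats 800000 in
/-- **Proposition 2 (lower bound, general form with variable sieving levels `z ≤ z_q < x^{1/2}`)
from Lemma 2 and the Corollary of Proposition 1 — PROVED** (p. 185: "A similar result holds for
lower bound, the function `F(s)` being replaced by `f(s)`"), given condition (1) for `ρ` (`hK`) and
the tail form of Mertens II for `ρ` (`hM2`), both proved in `IwaniecAlmostPrimesMertens.lean`.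
Every `q` with `ρ(q) > 0` and `z_q ≤ (MN)^{1/2}` is sieved by Lemma 2 at ITS OWN level `z_q`
(`M = x^{1−4ε'}/2^{⌊log₂ q⌋+1}`, `N = x^{1/15−ε'}`, `ε' = ε/1000`, Lemma 2 with `ε₂ = ε/4`); for
`z_q > (MN)^{1/2}` the main term is nonpositive (`main_term_lower_trivial`) and `S(𝒜_q, z_q) ≥ 0`
is used.  The remainders are grouped by the dyadic class of `q` only and bounded by
`abs_remainder_class_le_var` (binary comparison of `P⁺(n)` with `⌈z_q⌉ − 1` + hypercube
separation + the Corollary of Proposition 1), at the cost of the factor `⌊log₂⌈N⌉⌋ + 2 ≤ 2(⌊log₂ x⌋ + 1)`,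
so that the total remainder is `≤ 2(⌊log₂ x⌋+1)² e^{8ε₂⁻³} C(ε') x^{1−ε'} ≤ ε V(z) x`.
The constant is `C_γ = (L_f/γ + f_max + c₀(1/γ + 33)) e²/γ + 1` as in the constant-level case.
[cite: IwaniecInventiones1978, Proposition 2] -/
theorem proposition2_lower_of (h2 : lemma2_bilinearSieve) (h1c : proposition1_corollary)
    (hK : ∃ K : ℝ, 1 ≤ K ∧ ∀ w z : ℝ, 2 ≤ w → w < z →
      ∏ p ∈ (Nat.primesBelow ⌈z⌉₊).filter (fun p : ℕ => w ≤ (p : ℝ)), (1 - (rho p : ℝ) / p)⁻¹ ≤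
        Real.log z / Real.log w * (1 + K / Real.log w))
    (hM2 : ∃ C₂ : ℝ, ∀ w z : ℝ, 2 ≤ w → w < z →
      ∑ p ∈ (Nat.primesBelow ⌈z⌉₊).filter (fun p : ℕ => w ≤ (p : ℝ)), (rho p : ℝ) / p ≤
        Real.log (Real.log z / Real.log w) + C₂ / Real.log w) :
    proposition2_lower := by
  intro F f hFf γ hγ hγ2
  -- constants depending on `γ` and `f`
  obtain ⟨c₀, K, hc₀, hK1, HL2⟩ := lemma2_multisetAq h2 hK
  obtain ⟨Lf, hLip⟩ := hFf.exists_lipschitzOnWith_lower (a := 1 / 10) (b := 16 / (15 * γ) + 2)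
    (by norm_num)
  obtain ⟨fmax, hfmax⟩ := hFf.exists_bound_lower (a := 1 / 10) (b := 16 / (15 * γ) + 2)
    (by norm_num)
  set Cf : ℝ := Lf / γ + fmax with hCf
  set C₄ : ℝ := 1 / γ + 33 with hC₄
  set Rγ : ℝ := Real.exp 2 / γ with hRγ
  have hfmax0 : 0 ≤ fmax := by
    have h2mem : (2 : ℝ) ∈ Set.Icc (1 / 10 : ℝ) (16 / (15 * γ) + 2) :=
      ⟨by norm_num, by linarith [show (0 : ℝ) < 16 / (15 * γ) by positivity]⟩
    exact (abs_nonneg _).trans (hfmax 2 h2mem)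
  have hCf0 : 0 ≤ Cf := by positivity
  have hC₄0 : 0 < C₄ := by positivity
  have hRγ0 : 0 < Rγ := by positivity
  refine ⟨(Cf + c₀ * C₄) * Rγ + 1, fun ε hε => ?_⟩
  -- the case `ε ≥ 1` is vacuous (no `q` with `1 ≤ q < x^{1−ε} ≤ 1`)
  rcases le_or_gt 1 ε with hε1 | hε1
  · refine ⟨1, fun x hx zq c hzq hc => ?_⟩
    dsimp only
    have hempty : Finset.Ico 1 ⌈x ^ (1 - ε)⌉₊ = ∅ := by
      have h1 : x ^ (1 - ε) ≤ 1 := Real.rpow_le_one_of_one_le_of_nonpos hx (by linarith)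
      have h2 : ⌈x ^ (1 - ε)⌉₊ ≤ 1 := by
        have := Nat.ceil_le_ceil h1
        rwa [Nat.ceil_one] at this
      exact Finset.Ico_eq_empty_of_le h2
    rw [hempty, Finset.filter_empty, Finset.sum_empty, Finset.sum_empty, zero_sub]
    have hVx : 0 ≤ densityProd (x ^ γ) * x := mul_nonneg (densityProd_pos _).le (by linarith)
    have hC : 0 ≤ ((Cf + c₀ * C₄) * Rγ + 1) * ε := by positivity
    rw [mul_neg]
    linarith [mul_nonneg hVx hC]
  -- main case `0 < ε < 1`: parameters
  set ε' : ℝ := ε / 1000 with hε'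
  set ε₂ : ℝ := ε / 4 with hε₂
  have hε'0 : 0 < ε' := by positivity
  have hε'ε : ε' ≤ ε / 1000 := le_rfl
  have hε₂0 : 0 < ε₂ := by positivity
  have hε₂3 : ε₂ < 1 / 3 := by rw [hε₂]; linarith
  obtain ⟨C₁, hC₁⟩ := h1c ε' hε'0
  have hC₁0 : 0 ≤ C₁ := prop1_corollary_const_nonneg hC₁
  set Nx : ℝ → ℝ := fun x => max (x ^ (1 / 15 - ε')) 2 with hNx
  set Mi : ℝ → ℕ → ℝ := fun x i => max (x ^ (1 - 4 * ε') / 2 ^ (i + 1)) 2 with hMi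
  have hNx1 : ∀ x, 1 < Nx x := fun x => lt_of_lt_of_le one_lt_two (le_max_right _ _)
  have hMi1 : ∀ x i, 1 < Mi x i := fun x i => lt_of_lt_of_le one_lt_two (le_max_right _ _)
  -- Lemma 2's coefficients for every `(x, i)`
  choose Lc _au _bu al bl hLc _hau _hbu hal hbl Hq using
    fun (x : ℝ) (i : ℕ) => HL2 F f hFf ε₂ (Mi x i) (Nx x) hε₂0 hε₂3 (hMi1 x i) (hNx1 x)
  set Lmax : ℝ := Real.exp (8 * ε₂⁻¹ ^ 3) with hLmax
  have hLmax0 : 0 ≤ Lmax := (Real.exp_pos _).le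
  set B : ℝ := ε₂⁻¹ ^ 8 * Real.exp (K + 9) with hB
  have hB0 : 0 ≤ B := by positivity
  -- largeness conditions on `x`
  have hγ33 : 0 < min γ (1 / 33) := lt_min hγ (by norm_num)
  have EV : ∀ᶠ x : ℝ in atTop,
      2 ≤ x ∧ (2 : ℝ) ≤ x ^ γ ∧ (2 : ℝ) ≤ x ^ (1 / 15 - ε') ∧ (4 : ℝ) ≤ x ^ (ε - 4 * ε') ∧
      Real.log 2 ≤ ε' * Real.log x ∧
      (∀ t : ℝ, x ^ (min γ (1 / 33)) ≤ t →
        |densityProd t * Real.log t - lambda0| ≤ ε / 8 * lambda0) ∧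
      (∀ T : ℝ, 0 < T → Real.log x / 16 ≤ Real.log T →
        B * Real.log T ^ (-(1 / 3 : ℝ)) ≤ 3 * ε / 4) ∧
      (∀ T : Finset ℕ, (∀ q ∈ T, 1 ≤ q ∧ (q : ℝ) < x ∧ q.Coprime (primesProdBelow (x ^ γ))) →
        ∑ q ∈ T, (rho q : ℝ) / q ≤ Rγ) ∧
      ((⌊Real.logb 2 x⌋₊ : ℝ) + 1) ^ 2 * (2 * (Lmax * C₁)) * x ^ (1 - ε') ≤
        (ε * (7 / 8 * lambda0) / γ) * x / Real.log x ∧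
      (2 : ℝ) ≤ x ^ (1 - (1 / 15 - ε')) := by
    have e1 := eventually_ge_atTop (2 : ℝ)
    have e2 := (tendsto_rpow_atTop hγ).eventually_ge_atTop (2 : ℝ)
    have e3 := (tendsto_rpow_atTop (show 0 < 1 / 15 - ε' by rw [hε']; linarith)).eventually_ge_atTop (2 : ℝ)
    have e4 := (tendsto_rpow_atTop (show 0 < ε - 4 * ε' by rw [hε']; linarith)).eventually_ge_atTop (4 : ℝ)
    have e5 : ∀ᶠ x : ℝ in atTop, Real.log 2 ≤ ε' * Real.log x :=
      (Real.tendsto_log_atTop.const_mul_atTop hε'0).eventually_ge_atTop _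
    have e7 := eventually_forall_abs_densityProd_mul_log_sub_le
      (show 0 < ε / 8 * lambda0 by have := lambda0_pos; positivity) hγ33
    have e8 := eventually_E_small hB0 (show 0 < 3 * ε / 4 by positivity)
    have e9 := eventually_sum_rough_rho_div_le hγ (by linarith) hM2
    have e10 := eventually_classes_remainder_le (A := 2 * (Lmax * C₁)) (by positivity)
      (show 0 < ε * (7 / 8 * lambda0) / γ by have := lambda0_pos; positivity) hε'0
    have e11 := (tendsto_rpow_atTop (show 0 < 1 - (1 / 15 - ε') by rw [hε']; linarith)).eventually_ge_atTop (2 : ℝ)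
    filter_upwards [e1, e2, e3, e4, e5, e7, e8, e9, e10, e11] with x h1 h2 h3 h4 h5 h7 h8 h9 h10 h11
    exact ⟨h1, h2, h3, h4, h5, h7, h8, h9, h10, h11⟩
  obtain ⟨x₀, hx₀⟩ := Filter.eventually_atTop.mp EV
  refine ⟨x₀, fun x hx zq c hzq hc => ?_⟩
  obtain ⟨hx2, hxγ, hxN, hx4, hlog2, hΛ, hE, hR, hrem, hx1415⟩ := hx₀ x hx
  dsimp only
  set Q := (Finset.Ico 1 ⌈x ^ (1 - ε)⌉₊).filter fun q : ℕ =>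
    q.Coprime (primesProdBelow (zq q)) with hQ
  -- basic facts about `x`
  have hx1 : 1 < x := by linarith
  have hx0 : 0 < x := by linarith
  set L := Real.log x with hL
  have hL0 : 0 < L := Real.log_pos hx1
  set z := x ^ γ with hz
  have hz0 : 0 < z := Real.rpow_pos_of_pos hx0 γ
  have hlz : Real.log z = γ * L := Real.log_rpow hx0 γ
  set N := x ^ (1 / 15 - ε') with hN
  have hNx_eq : Nx x = N := max_eq_left hxN
  set D := x ^ (1 - 4 * ε') with hD
  have hD0 : 0 < D := Real.rpow_pos_of_pos hx0 _
  have hxε : x ^ (1 - ε) < x := by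
    conv_rhs => rw [← Real.rpow_one x]
    exact Real.rpow_lt_rpow_of_exponent_lt hx1 (by linarith)
  have hxa : x ^ (min γ (1 / 33)) ≤ z :=
    Real.rpow_le_rpow_of_exponent_le hx1.le (min_le_left _ _)
  -- the levels `z_q`
  have hzq2 : ∀ q, 2 ≤ zq q := fun q => hxγ.trans (hzq q).1
  have hlzq0 : ∀ q, 0 < Real.log (zq q) := fun q => Real.log_pos (by linarith [hzq2 q])
  -- `Λ` at `z`
  have hΛz := hΛ z hxa
  set Λz := densityProd z * Real.log z with hΛz_def
  have hΛz_lo : 7 / 8 * lambda0 ≤ Λz := by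
    have := (abs_le.mp hΛz).1
    have hε8 : ε / 8 * lambda0 ≤ 1 / 8 * lambda0 :=
      mul_le_mul_of_nonneg_right (by linarith) lambda0_pos.le
    linarith
  have hΛz0 : 0 ≤ Λz := by linarith [hΛz_lo, lambda0_pos]
  have hΛzZ0 : ∀ q, 0 ≤ Λz / Real.log (zq q) := fun q => div_nonneg hΛz0 (hlzq0 q).le
  have hVz : densityProd z = Λz / Real.log z := by
    rw [hΛz_def, hlz]; field_simp
  -- membership facts for `q ∈ Q`
  have hQmem : ∀ q ∈ Q, 1 ≤ q ∧ (q : ℝ) < x ^ (1 - ε) ∧ q.Coprime (primesProdBelow (zq q)) := by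
    intro q hq
    rw [hQ, Finset.mem_filter, Finset.mem_Ico] at hq
    exact ⟨hq.1.1, Nat.lt_ceil.mp hq.1.2, hq.2⟩
  -- per-`q` data: the dyadic class
  set iq : ℕ → ℕ := fun q => Nat.log 2 q with hiq
  -- (d0) dyadic range of `q` in `ℕ`
  have hd0 : ∀ q ∈ Q, 2 ^ iq q ≤ q ∧ q < 2 ^ (iq q + 1) := by
    intro q hq
    have hq1 := (hQmem q hq).1
    exact ⟨Nat.pow_log_le_self 2 (by omega), Nat.lt_pow_succ_log_self (by norm_num) q⟩
  -- (d1) dyadic range of `q`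
  have hd1 : ∀ q ∈ Q, (2 : ℝ) ^ iq q ≤ q ∧ (q : ℝ) < 2 * 2 ^ iq q := by
    intro q hq
    obtain ⟨hlo, hhi⟩ := hd0 q hq
    constructor
    · exact_mod_cast hlo
    · have h' : (q : ℝ) < ((2 ^ (iq q + 1) : ℕ) : ℝ) := by exact_mod_cast hhi
      simpa [pow_succ, mul_comm] using h'
  -- (d2) `Mi x (iq q) = D / 2^{iq+1}` and `q · M ≤ D`
  have hd2 : ∀ q ∈ Q, Mi x (iq q) = D / 2 ^ (iq q + 1) ∧ (q : ℝ) * Mi x (iq q) ≤ D := by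
    intro q hq
    obtain ⟨hq1, hqx, -⟩ := hQmem q hq
    obtain ⟨hlo, hhi⟩ := hd1 q hq
    have hq0 : (0 : ℝ) < q := by exact_mod_cast hq1
    have hpow : (0 : ℝ) < 2 ^ (iq q + 1) := by positivity
    -- `D / 2^{iq+1} ≥ 2`
    have hge2 : (2 : ℝ) ≤ D / 2 ^ (iq q + 1) := by
      rw [le_div_iff₀ hpow]
      have h1 : (2 : ℝ) ^ (iq q + 1) ≤ 2 * q := by rw [pow_succ]; linarith
      have h2 : 2 * (q : ℝ) * 4 ≤ 2 * x ^ (1 - ε) * x ^ (ε - 4 * ε') := by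
        have := mul_le_mul hqx.le hx4 (by norm_num) (by positivity)
        linarith
      have h3 : x ^ (1 - ε) * x ^ (ε - 4 * ε') = D := by
        rw [hD, ← Real.rpow_add hx0]; ring_nf
      have h2' : 2 * (q : ℝ) * 4 ≤ 2 * D := by rw [← h3]; linarith [h2]
      linarith
    have hM : Mi x (iq q) = D / 2 ^ (iq q + 1) := max_eq_left hge2
    refine ⟨hM, ?_⟩
    rw [hM]
    rw [mul_div_assoc', div_le_iff₀ hpow, pow_succ]
    have h5 := mul_le_mul_of_nonneg_right hhi.le hD0.le
    have e5 : 2 * (2 : ℝ) ^ iq q * D = D * (2 ^ iq q * 2) := by ring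
    linarith
  -- (d4) the size of `log(M N)` against `log(y/q)`
  have hd4 : ∀ q ∈ Q, 0 < Mi x (iq q) * Nx x ∧
      Real.log (x ^ (16 / 15 : ℝ) / q) - 6 * ε' * L ≤ Real.log (Mi x (iq q) * Nx x) ∧
      Real.log (Mi x (iq q) * Nx x) ≤ Real.log (x ^ (16 / 15 : ℝ) / q) ∧
      L / 16 ≤ Real.log (Mi x (iq q) * Nx x) := by
    intro q hq
    obtain ⟨hq1, hqx, -⟩ := hQmem q hq
    obtain ⟨hlo, hhi⟩ := hd1 q hq
    obtain ⟨hM, -⟩ := hd2 q hq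
    have hq0 : (0 : ℝ) < q := by exact_mod_cast hq1
    have hpow : (0 : ℝ) < 2 ^ (iq q + 1) := by positivity
    have hMN0 : 0 < Mi x (iq q) * Nx x := mul_pos (by linarith [hMi1 x (iq q)]) (by linarith [hNx1 x])
    refine ⟨hMN0, ?_⟩
    rw [hM, hNx_eq, Real.log_mul (by positivity) (by positivity), Real.log_div hD0.ne' hpow.ne',
      hD, hN, Real.log_rpow hx0, Real.log_rpow hx0, Real.log_pow,
      Real.log_div (by positivity) hq0.ne', Real.log_rpow hx0]
    -- `iq log 2 ≤ log q < (iq + 1) log 2`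
    have hlq_lo : (iq q : ℝ) * Real.log 2 ≤ Real.log q := by
      rw [← Real.log_pow]; exact Real.log_le_log (by positivity) hlo
    have hlq_hi : Real.log q < ((iq q : ℝ) + 1) * Real.log 2 := by
      have := Real.log_lt_log hq0 hhi
      rw [Real.log_mul (by norm_num) (by positivity), Real.log_pow] at this
      linarith
    have hl2 : 0 < Real.log 2 := Real.log_pos (by norm_num)
    have hlogq : Real.log q < (1 - ε) * L := by
      rw [← Real.log_rpow hx0]; exact Real.log_lt_log hq0 hqx
    have hε'L_eq : ε' * L = ε * L / 1000 := by rw [hε']; ring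
    have hεL_lt : ε * L < L := mul_lt_of_lt_one_left hL0 hε1
    have hεL0 : 0 < ε * L := mul_pos hε hL0
    push_cast
    rw [← hL]
    refine ⟨by linarith, by linarith, by linarith⟩
  -- (d6) the class index is at most `⌊log₂ x⌋`
  have hd6 : ∀ q ∈ Q, iq q ≤ ⌊Real.logb 2 x⌋₊ := by
    intro q hq
    obtain ⟨-, hqx, -⟩ := hQmem q hq
    exact le_floor_logb_of_pow_le hx0 ((hd1 q hq).1.trans (hqx.le.trans hxε.le))
  -- the number of comparison levels is at most `2(⌊log₂ x⌋ + 1)`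
  have hlevels : (Nat.log 2 ⌈Nx x⌉₊ : ℝ) + 2 ≤ 2 * ((⌊Real.logb 2 x⌋₊ : ℝ) + 1) := by
    rw [hNx_eq]
    have hN1 : 1 ≤ N := by linarith
    have hNx' : N * x ^ (1 - (1 / 15 - ε')) = x := by
      rw [hN, ← Real.rpow_add hx0]; norm_num
    have h2N : 2 * N ≤ x := by
      have := mul_le_mul_of_nonneg_left hx1415 (by linarith : (0 : ℝ) ≤ N)
      linarith
    have hceil : (⌈N⌉₊ : ℝ) ≤ x := by
      have := Nat.ceil_lt_add_one (by linarith : (0 : ℝ) ≤ N)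
      linarith
    have hpow : (2 : ℝ) ^ Nat.log 2 ⌈N⌉₊ ≤ x := by
      have hc0 : ⌈N⌉₊ ≠ 0 := by
        have : 0 < ⌈N⌉₊ := Nat.ceil_pos.mpr (by linarith)
        omega
      have h1 : 2 ^ Nat.log 2 ⌈N⌉₊ ≤ ⌈N⌉₊ := Nat.pow_log_le_self 2 hc0
      have h1' : ((2 ^ Nat.log 2 ⌈N⌉₊ : ℕ) : ℝ) ≤ (⌈N⌉₊ : ℝ) := by exact_mod_cast h1
      push_cast at h1'
      linarith
    have hk := le_floor_logb_of_pow_le hx0 hpow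
    have hk' : (Nat.log 2 ⌈N⌉₊ : ℝ) ≤ (⌊Real.logb 2 x⌋₊ : ℝ) := by exact_mod_cast hk
    linarith
  -- the remainder attached to `q` and the per-`q` inequality
  set RR : ℕ → ℕ → ℕ → ℝ := fun i l q =>
    ∑ m ∈ Finset.Ico 1 ⌈Mi x i⌉₊, ∑ n ∈ Finset.Ico 1 ⌈Nx x⌉₊,
      (if m * n ∣ primesProdBelow (zq q) then al x i l m * bl x i l n * rem x (q * (m * n)) else 0)
    with hRR
  set Rq : ℕ → ℝ := fun q => ∑ l ∈ Finset.range (Lc x (iq q)), RR (iq q) l q with hRq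
  set C' : ℝ := Cf + c₀ * C₄ with hC'
  have hC'0 : 0 ≤ C' := by positivity
  -- `q` is *active* when Lemma 2 applies at the level `z_q`, i.e. `z_q ≤ (MN)^{1/2}`
  have hkey : ∀ q ∈ Q,
      c q * ((rho q : ℝ) * x / q) * (Λz / Real.log (zq q)) *
          (f (Real.log (x ^ (16 / 15 : ℝ) / q) / Real.log (zq q)) - C' * ε) -
        (if 0 < rho q ∧ zq q ≤ (Mi x (iq q) * Nx x) ^ (1 / 2 : ℝ) then c q * Rq q else 0) ≤
      c q * (siftedCount x q (zq q) : ℝ) := by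
    intro q hq
    obtain ⟨hq1, hqx, hcop⟩ := hQmem q hq
    have hc0 : 0 ≤ c q := (hc q).1
    rcases Nat.eq_zero_or_pos (rho q) with hρ | hρ
    · rw [siftedCount_eq_zero_of_rho_eq_zero x hρ, if_neg (by omega), hρ]
      simp
    obtain ⟨hMN0, hMNlo, hMNhi, hMN16⟩ := hd4 q hq
    have hq0' : (0 : ℝ) < q := by exact_mod_cast hq1
    have hX0 : 0 ≤ (rho q : ℝ) * x / q := by positivity
    have hS0 : (0 : ℝ) ≤ c q * (siftedCount x q (zq q) : ℝ) := by positivity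
    have hZ := hzq q
    have hZ2 := hzq2 q
    have hlZ0 := hlzq0 q
    have hΛZ := hΛ (zq q) (hxa.trans hZ.1)
    by_cases hact : zq q ≤ (Mi x (iq q) * Nx x) ^ (1 / 2 : ℝ)
    · -- Lemma 2, lower bound, at the level `z_q`
      rw [if_pos ⟨hρ, hact⟩]
      have H := (Hq x (iq q) x q hx0 (by omega) hρ (zq q) hZ2 hact hcop).2
      dsimp only at H
      -- main term and `E`
      have hmain := main_term_lower hFf hγ hγ2 hLip hfmax hε hε1.le hε'0.le hε'ε hx1 hZ
        ⟨hq1, hqx⟩ hMN0 hact ⟨hMNlo, hMNhi⟩ hΛZ hΛz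
      have hu : zq q = min (zq q) ((Mi x (iq q) * Nx x) ^ (1 / 2 : ℝ)) := (min_eq_left hact).symm
      have hVle := densityProd_level_le hγ hε hε1.le hε'0.le hε'ε hx1 hZ ⟨hq1, hqx⟩
        ⟨le_rfl, hZ.1⟩ hMN0 hMNlo hu hΛZ hΛz
      have hEle : c₀ * (ε₂ + ε₂⁻¹ ^ 8 * Real.exp (K + 9) *
          Real.log (Mi x (iq q) * Nx x) ^ (-(1 / 3 : ℝ))) ≤ c₀ * ε := by
        refine mul_le_mul_of_nonneg_left ?_ hc₀.le
        have := hE _ hMN0 hMN16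
        rw [hε₂]; linarith
      have hV0 : 0 ≤ densityProd (zq q) := (densityProd_pos _).le
      -- combine: the target main term is below Lemma 2's main term
      have hcomb : ((rho q : ℝ) * x / q) * (Λz / Real.log (zq q)) *
          (f (Real.log (x ^ (16 / 15 : ℝ) / q) / Real.log (zq q)) - C' * ε) ≤
          densityProd (zq q) * ((rho q : ℝ) * x / q) *
            (f (Real.log (Mi x (iq q) * Nx x) / Real.log (zq q)) -
              c₀ * (ε₂ + ε₂⁻¹ ^ 8 * Real.exp (K + 9) *
                Real.log (Mi x (iq q) * Nx x) ^ (-(1 / 3 : ℝ)))) := by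
        have h1 : Λz / Real.log (zq q) *
            (f (Real.log (x ^ (16 / 15 : ℝ) / q) / Real.log (zq q)) - Cf * ε) -
            Λz / Real.log (zq q) * C₄ * (c₀ * ε) ≤
            densityProd (zq q) * f (Real.log (Mi x (iq q) * Nx x) / Real.log (zq q)) -
              densityProd (zq q) * (c₀ * ε) :=
          sub_le_sub hmain (mul_le_mul_of_nonneg_right hVle (by positivity))
        have h2 : densityProd (zq q) * f (Real.log (Mi x (iq q) * Nx x) / Real.log (zq q)) -
              densityProd (zq q) * (c₀ * ε) ≤
            densityProd (zq q) * (f (Real.log (Mi x (iq q) * Nx x) / Real.log (zq q)) -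
              c₀ * (ε₂ + ε₂⁻¹ ^ 8 * Real.exp (K + 9) *
                Real.log (Mi x (iq q) * Nx x) ^ (-(1 / 3 : ℝ)))) := by
          rw [mul_sub]; exact sub_le_sub le_rfl (mul_le_mul_of_nonneg_left hEle hV0)
        have h3 := mul_le_mul_of_nonneg_left (h1.trans h2) hX0
        have e : (rho q : ℝ) * x / q * (Λz / Real.log (zq q) *
            (f (Real.log (x ^ (16 / 15 : ℝ) / q) / Real.log (zq q)) - Cf * ε) -
              Λz / Real.log (zq q) * C₄ * (c₀ * ε)) =
            (rho q : ℝ) * x / q * (Λz / Real.log (zq q)) *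
              (f (Real.log (x ^ (16 / 15 : ℝ) / q) / Real.log (zq q)) - C' * ε) := by
          rw [hC']; ring
        calc _ = _ := e.symm
          _ ≤ _ := h3
          _ = _ := by ring
      calc c q * ((rho q : ℝ) * x / q) * (Λz / Real.log (zq q)) *
              (f (Real.log (x ^ (16 / 15 : ℝ) / q) / Real.log (zq q)) - C' * ε) - c q * Rq q
          = c q * (((rho q : ℝ) * x / q) * (Λz / Real.log (zq q)) *
              (f (Real.log (x ^ (16 / 15 : ℝ) / q) / Real.log (zq q)) - C' * ε)) - c q * Rq q := by
            ring
        _ ≤ c q * (densityProd (zq q) * ((rho q : ℝ) * x / q) *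
            (f (Real.log (Mi x (iq q) * Nx x) / Real.log (zq q)) -
              c₀ * (ε₂ + ε₂⁻¹ ^ 8 * Real.exp (K + 9) *
                Real.log (Mi x (iq q) * Nx x) ^ (-(1 / 3 : ℝ))))) - c q * Rq q :=
            sub_le_sub_right (mul_le_mul_of_nonneg_left hcomb hc0) _
        _ = c q * (densityProd (zq q) * ((rho q : ℝ) * x / q) *
            (f (Real.log (Mi x (iq q) * Nx x) / Real.log (zq q)) -
              c₀ * (ε₂ + ε₂⁻¹ ^ 8 * Real.exp (K + 9) *
                Real.log (Mi x (iq q) * Nx x) ^ (-(1 / 3 : ℝ)))) - Rq q) := by ring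
        _ ≤ c q * (siftedCount x q (zq q) : ℝ) := mul_le_mul_of_nonneg_left H hc0
    · -- `z_q > (MN)^{1/2}`: the main term is nonpositive
      rw [if_neg (fun h => hact h.2), sub_zero]
      have hlt : (Mi x (iq q) * Nx x) ^ (1 / 2 : ℝ) < zq q := lt_of_not_ge hact
      have htriv := main_term_lower_trivial hFf hγ hγ2 hLip hfmax hε hε1.le hε'0.le hε'ε hx1 hZ
        ⟨hq1, hqx⟩ hMN0 hlt hMNlo
      have hle : Λz / Real.log (zq q) *
          (f (Real.log (x ^ (16 / 15 : ℝ) / q) / Real.log (zq q)) - C' * ε) ≤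
          Λz / Real.log (zq q) *
            (f (Real.log (x ^ (16 / 15 : ℝ) / q) / Real.log (zq q)) - Cf * ε) := by
        refine mul_le_mul_of_nonneg_left (sub_le_sub_left ?_ _) (hΛzZ0 q)
        refine mul_le_mul_of_nonneg_right ?_ hε.le
        rw [hC']; linarith [mul_nonneg hc₀.le hC₄0.le]
      have hneg : Λz / Real.log (zq q) *
          (f (Real.log (x ^ (16 / 15 : ℝ) / q) / Real.log (zq q)) - C' * ε) ≤ 0 := hle.trans htriv
      calc c q * ((rho q : ℝ) * x / q) * (Λz / Real.log (zq q)) *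
              (f (Real.log (x ^ (16 / 15 : ℝ) / q) / Real.log (zq q)) - C' * ε)
          = c q * ((rho q : ℝ) * x / q) * (Λz / Real.log (zq q) *
              (f (Real.log (x ^ (16 / 15 : ℝ) / q) / Real.log (zq q)) - C' * ε)) := by ring
        _ ≤ 0 := mul_nonpos_of_nonneg_of_nonpos (mul_nonneg hc0 hX0) hneg
        _ ≤ c q * (siftedCount x q (zq q) : ℝ) := hS0
  -- sum the main terms
  have hmainsum : ∑ q ∈ Q, c q * ((rho q : ℝ) * x / q) * (Λz / Real.log (zq q)) *
      (f (Real.log (x ^ (16 / 15 : ℝ) / q) / Real.log (zq q)) - C' * ε) =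
      densityProd z * x * ∑ q ∈ Q, c q * (rho q : ℝ) / q *
        f (Real.log (x ^ (16 / 15 : ℝ) / q) / Real.log (zq q)) * (Real.log z / Real.log (zq q)) -
      densityProd z * x * (C' * ε) *
        ∑ q ∈ Q, c q * (rho q : ℝ) / q * (Real.log z / Real.log (zq q)) := by
    rw [Finset.mul_sum, Finset.mul_sum, ← Finset.sum_sub_distrib]
    refine Finset.sum_congr rfl fun q hq => ?_
    rw [hVz]
    have hlz0 : Real.log z ≠ 0 := by rw [hlz]; positivity
    have hlZ0' : Real.log (zq q) ≠ 0 := (hlzq0 q).ne'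
    have hq0 : (q : ℝ) ≠ 0 := by have := (hQmem q hq).1; positivity
    field_simp
    try ring
  -- the density sum is `O_γ(1)`
  have hdens : ∑ q ∈ Q, c q * (rho q : ℝ) / q * (Real.log z / Real.log (zq q)) ≤ Rγ := by
    have h1 : ∀ q ∈ Q, c q * (rho q : ℝ) / q * (Real.log z / Real.log (zq q)) ≤
        (rho q : ℝ) / q := by
      intro q _
      have hlzZ : Real.log z ≤ Real.log (zq q) := Real.log_le_log hz0 (hzq q).1
      have hlz0 : 0 < Real.log z := by rw [hlz]; positivity
      have hratio : Real.log z / Real.log (zq q) ≤ 1 := (div_le_one (hlzq0 q)).mpr hlzZ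
      have hρq : 0 ≤ (rho q : ℝ) / q := by positivity
      have hr0 : 0 ≤ Real.log z / Real.log (zq q) := div_nonneg hlz0.le (hlzq0 q).le
      calc c q * (rho q : ℝ) / q * (Real.log z / Real.log (zq q))
          = c q * (Real.log z / Real.log (zq q)) * ((rho q : ℝ) / q) := by ring
        _ ≤ 1 * 1 * ((rho q : ℝ) / q) := by
            refine mul_le_mul_of_nonneg_right ?_ hρq
            exact mul_le_mul (hc q).2 hratio hr0 zero_le_one
        _ = (rho q : ℝ) / q := by ring
    refine (Finset.sum_le_sum h1).trans (hR Q fun q hq => ?_)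
    obtain ⟨hq1, hqx, hcop⟩ := hQmem q hq
    exact ⟨hq1, hqx.trans hxε,
      Nat.Coprime.coprime_dvd_right (primesProdBelow_dvd_of_le (hzq q).1) hcop⟩
  -- the remainder sum is `≤ ε V(z) x`
  have hremsum : ∑ q ∈ Q, (if 0 < rho q ∧ zq q ≤ (Mi x (iq q) * Nx x) ^ (1 / 2 : ℝ)
      then c q * Rq q else 0) ≤ ε * (densityProd z * x) := by
    rw [← Finset.sum_filter]
    set Q' := Q.filter fun q => 0 < rho q ∧ zq q ≤ (Mi x (iq q) * Nx x) ^ (1 / 2 : ℝ) with hQ'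
    have hQ'sub : Q' ⊆ Q := Finset.filter_subset _ _
    set Kset := Q'.image iq with hKset
    rw [← Finset.sum_fiberwise_of_maps_to (s := Q') (t := Kset) (g := iq)
      (fun q hq => Finset.mem_image_of_mem iq hq)]
    -- each class contributes at most `Lmax · 2(⌊log₂ x⌋+1) · C₁ x^{1−ε'}`
    have hclass : ∀ k ∈ Kset, ∑ q ∈ Q'.filter (fun q => iq q = k), c q * Rq q ≤
        Lmax * (2 * ((⌊Real.logb 2 x⌋₊ : ℝ) + 1)) * (C₁ * x ^ (1 - ε')) := by
      intro k _
      set T := Q'.filter (fun q => iq q = k) with hT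
      have hTmem : ∀ q ∈ T, q ∈ Q ∧ iq q = k := by
        intro q hq
        rw [hT, Finset.mem_filter, hQ', Finset.mem_filter] at hq
        exact ⟨hq.1.1, hq.2⟩
      -- rewrite `Rq q` on the fiber through `k`
      have hRq_eq : ∀ q ∈ T, Rq q = ∑ l ∈ Finset.range (Lc x k), RR k l q := by
        intro q hq
        obtain ⟨-, hi⟩ := hTmem q hq
        simp only [hRq, hi]
      rw [show ∑ q ∈ T, c q * Rq q = ∑ q ∈ T, c q * ∑ l ∈ Finset.range (Lc x k), RR k l q
        from Finset.sum_congr rfl fun q hq => by rw [hRq_eq q hq]]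
      -- swap `q` and `l`
      rw [show ∑ q ∈ T, c q * ∑ l ∈ Finset.range (Lc x k), RR k l q =
          ∑ l ∈ Finset.range (Lc x k), ∑ q ∈ T, c q * RR k l q by
        rw [Finset.sum_comm]; exact Finset.sum_congr rfl fun q _ => Finset.mul_sum _ _ _]
      -- each `l` contributes at most `2(⌊log₂ x⌋+1) C₁ x^{1−ε'}`
      have hl : ∀ l ∈ Finset.range (Lc x k), ∑ q ∈ T, c q * RR k l q ≤
          (2 * ((⌊Real.logb 2 x⌋₊ : ℝ) + 1)) * (C₁ * x ^ (1 - ε')) := by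
        intro l _
        have hT' : ∀ q ∈ T, 0 < q ∧ q.Coprime (primesProdBelow (zq q)) ∧
            (q : ℝ) * Mi x k ≤ D ∧ 2 ^ k ≤ q ∧ q < 2 ^ (k + 1) ∧ 2 ≤ zq q := by
          intro q hq
          obtain ⟨hqQ, hi⟩ := hTmem q hq
          have h2' := (hd2 q hqQ).2
          have h0' := hd0 q hqQ
          rw [hi] at h2' h0'
          exact ⟨(hQmem q hqQ).1, (hQmem q hqQ).2.2, h2', h0'.1, h0'.2, hzq2 q⟩
        have hBcor : ∀ b' : ℕ → ℝ, (∀ n, |b' n| ≤ 1) → (∀ n, ¬ Squarefree n → b' n = 0) →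
            ∑ m' ∈ Finset.Ico 1 ⌈D⌉₊, |bilinearB x b' m' (Nx x)| ≤ C₁ * x ^ (1 - ε') := by
          intro b' hb1 hb2
          have hcor := hC₁ x b' hx2 hb1 hb2
          rw [← hN, ← hNx_eq] at hcor
          exact hcor
        have habs := abs_remainder_class_le_var x (Mi x k) (Nx x) D zq k T c (al x k l)
          (bl x k l) hT' (fun q => abs_le.mpr ⟨by linarith [(hc q).1], (hc q).2⟩) (hal x k l)
          (hbl x k l) hBcor
        refine (le_abs_self _).trans (habs.trans ?_)
        exact mul_le_mul_of_nonneg_right hlevels (by positivity)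
      calc ∑ l ∈ Finset.range (Lc x k), ∑ q ∈ T, c q * RR k l q
          ≤ ∑ l ∈ Finset.range (Lc x k), (2 * ((⌊Real.logb 2 x⌋₊ : ℝ) + 1)) * (C₁ * x ^ (1 - ε')) :=
            Finset.sum_le_sum hl
        _ = (Lc x k : ℝ) * ((2 * ((⌊Real.logb 2 x⌋₊ : ℝ) + 1)) * (C₁ * x ^ (1 - ε'))) := by
            rw [Finset.sum_const, Finset.card_range, nsmul_eq_mul]
        _ ≤ Lmax * ((2 * ((⌊Real.logb 2 x⌋₊ : ℝ) + 1)) * (C₁ * x ^ (1 - ε'))) :=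
            mul_le_mul_of_nonneg_right (hLc x k) (by positivity)
        _ = Lmax * (2 * ((⌊Real.logb 2 x⌋₊ : ℝ) + 1)) * (C₁ * x ^ (1 - ε')) := by ring
    -- number of classes
    have hKcard : (Kset.card : ℝ) ≤ (⌊Real.logb 2 x⌋₊ : ℝ) + 1 := by
      have hsub : Kset ⊆ Finset.range (⌊Real.logb 2 x⌋₊ + 1) := by
        intro k hk
        obtain ⟨q, hq, rfl⟩ := Finset.mem_image.mp hk
        rw [Finset.mem_range]
        exact Nat.lt_succ_of_le (hd6 q (hQ'sub hq))
      have := Finset.card_le_card hsub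
      rw [Finset.card_range] at this
      have h' : (Kset.card : ℝ) ≤ ((⌊Real.logb 2 x⌋₊ + 1 : ℕ) : ℝ) := by exact_mod_cast this
      push_cast at h'
      exact h'
    have hfl0 : (0 : ℝ) ≤ (⌊Real.logb 2 x⌋₊ : ℝ) + 1 := by positivity
    calc ∑ k ∈ Kset, ∑ q ∈ Q'.filter (fun q => iq q = k), c q * Rq q
        ≤ ∑ k ∈ Kset, Lmax * (2 * ((⌊Real.logb 2 x⌋₊ : ℝ) + 1)) * (C₁ * x ^ (1 - ε')) :=
          Finset.sum_le_sum hclass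
      _ = (Kset.card : ℝ) * (Lmax * (2 * ((⌊Real.logb 2 x⌋₊ : ℝ) + 1)) * (C₁ * x ^ (1 - ε'))) := by
          rw [Finset.sum_const, nsmul_eq_mul]
      _ ≤ ((⌊Real.logb 2 x⌋₊ : ℝ) + 1) *
            (Lmax * (2 * ((⌊Real.logb 2 x⌋₊ : ℝ) + 1)) * (C₁ * x ^ (1 - ε'))) :=
          mul_le_mul_of_nonneg_right hKcard (by positivity)
      _ = ((⌊Real.logb 2 x⌋₊ : ℝ) + 1) ^ 2 * (2 * (Lmax * C₁)) * x ^ (1 - ε') := by ring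
      _ ≤ (ε * (7 / 8 * lambda0) / γ) * x / Real.log x := hrem
      _ ≤ ε * (densityProd z * x) := by
          rw [hVz, hlz, div_le_iff₀ hL0]
          have : ε * (7 / 8 * lambda0) / γ * x = ε * ((7 / 8 * lambda0) / (γ * L) * x) * L := by
            field_simp
          rw [this]
          refine mul_le_mul_of_nonneg_right (mul_le_mul_of_nonneg_left ?_ hε.le) hL0.le
          exact mul_le_mul_of_nonneg_right (div_le_div_of_nonneg_right hΛz_lo (by positivity)) hx0.le
  -- conclusion
  have htotal := Finset.sum_le_sum hkey
  rw [Finset.sum_sub_distrib, hmainsum] at htotal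
  have hVx : 0 ≤ densityProd z * x := mul_nonneg (densityProd_pos _).le hx0.le
  have hA : densityProd z * x * (C' * ε) *
      ∑ q ∈ Q, c q * (rho q : ℝ) / q * (Real.log z / Real.log (zq q)) ≤
      densityProd z * x * (C' * ε) * Rγ :=
    mul_le_mul_of_nonneg_left hdens (mul_nonneg hVx (mul_nonneg hC'0 hε.le))
  calc densityProd z * x * (∑ q ∈ Q, c q * (rho q : ℝ) / q *
          f (Real.log (x ^ (16 / 15 : ℝ) / q) / Real.log (zq q)) * (Real.log z / Real.log (zq q)) -
        ((Cf + c₀ * C₄) * Rγ + 1) * ε)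
      = densityProd z * x * ∑ q ∈ Q, c q * (rho q : ℝ) / q *
          f (Real.log (x ^ (16 / 15 : ℝ) / q) / Real.log (zq q)) * (Real.log z / Real.log (zq q)) -
        densityProd z * x * (C' * ε) * Rγ - ε * (densityProd z * x) := by rw [hC']; ring
    _ ≤ densityProd z * x * ∑ q ∈ Q, c q * (rho q : ℝ) / q *
          f (Real.log (x ^ (16 / 15 : ℝ) / q) / Real.log (zq q)) * (Real.log z / Real.log (zq q)) -
        densityProd z * x * (C' * ε) *
          ∑ q ∈ Q, c q * (rho q : ℝ) / q * (Real.log z / Real.log (zq q)) -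
        ∑ q ∈ Q, (if 0 < rho q ∧ zq q ≤ (Mi x (iq q) * Nx x) ^ (1 / 2 : ℝ)
          then c q * Rq q else 0) := by linarith [hA, hremsum]
    _ ≤ ∑ q ∈ Q, c q * (siftedCount x q (zq q) : ℝ) := htotal

/-! ### Assembly: the general lower bound from Lemma 2 and Proposition 1 -/

/-- **Proposition 2 (lower bound, general form) from Lemma 2 and Proposition 1 — PROVED** (the
Corollary of Proposition 1 by `proposition1_corollary_of`, the Mertens inputs by
`rho_sieveConditionOne` and `exists_sum_rho_div_filter_le`).  After this, `proposition2_lower`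
rests on exactly the two named inputs `lemma2_bilinearSieve` (Acta Arith. 37 (1980), Theorem 1)
and `proposition1` (p. 176), like the rest of the paper. [cite: IwaniecInventiones1978, Proposition 2] -/
theorem proposition2_lower_of_lemma2_of_proposition1 (h2 : lemma2_bilinearSieve)
    (h1 : proposition1) : proposition2_lower :=
  proposition2_lower_of h2 (proposition1_corollary_of h1) rho_sieveConditionOne
    exists_sum_rho_div_filter_le

end Literature.NumberTheory.Sieve.Iwaniec1978

end
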